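import Literature.NumberTheory.Automorphic.UnitaryGroupUnipotentTruncatedTracePolynomial
import Literature.NumberTheory.Automorphic.UnitaryGroupHeisenbergPartClosed
import Literature.NumberTheory.Automorphic.UnitaryGroupHeisenbergPartSplit
import HarnessLib

/-!
# The unipotent term `J^T_𝔬(f) = A·log T + B` (`𝔬 = z·𝒰(F)`), the (E) road discharged:
# hypotheses-first in the centre-lattice evaluation, the `K_U`-average of the `ξ`-sum and `ψ ∈ 𝒮(𝔸_E)` only
(Rogawski, *Automorphic Representations of Unitary Groups in Three Variables* (1990), Prop. 7.3.2 (pp. 96–97): «`J^T_G(𝔬_st, f)` is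
equal to the sum of the following terms (a)–(e)»; Arthur, *The trace formula in invariant form*, Ann. of Math. 114 (1981),
Prop. 2.3.)

Topic `NumberTheory/Automorphic`; namespace `Literature.NumberTheory.Automorphic.UnitaryGroup`. THEOREMS ONLY over accepted tree
modules (no definition, no named fact, no instance, no notation, no `sorry`). Item (L5-i) «the unipotent term `P_{z·𝒰}`» of the
T1-qs LAW 5 road of `Cruxes/H413/Lines/F0_T1InnerFormTraceIdentity.lean` (cell `pub/hodgecm-mathlib`, crux H413): the PARTS-FREE
form of ★ (F) `truncatedTraceClass_central_eq_linear_of_parts` (`UnitaryGroupUnipotentTruncatedTracePolynomial`) on the (E) side —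
its binders `hsplit` and `hE` DISCHARGED by ★ `bracket_eq_centrePart_add_heisPart` (`UnitaryGroupHeisenbergPartSplit`) and ★
`heisPart_integral_eq_linear` (`UnitaryGroupHeisenbergPartClosed`), the (HINT) input of the latter by ★
`exists_forall_lintegral_weight_mul_enorm_bracket_lt_top` at the LAW-3 integrability `hkint`. What remains as hypotheses, each
named for its holder: the Iwasawa decomposition `hBK` (★ at the CM pin), the centre-lattice letters `hCinv`, `hCfin`, `hCi`,
`hCv` (the (C) road, Prop. 7.3.2 (c)+(d)), the `K_U`-average of the `ξ`-sum `hκ`∕`hκi` (leaf (ET-κ)), `hψ : ψ ∈ 𝒮(𝔸_E)` (★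
`integral_kAverage_heisChart_mem_schwartzBruhatAdele'` modulo archimedean smoothness) and `hkint` (★ `truncatedKernelClassIntegrable_cm`
at the CM pin). OUTPUT **`truncatedTraceClass_central_eq_linear`**: constants `C₁ > 0`, `C₂ ∈ (0,∞)` and `T₂` with, for `T > T₂`,

  `J^T_𝔬(f) = c_μ·A·log T + (μ(X)·f(z₁) + c_μ·(Cc + B))`,

`A = C₁·μ_X(D_E)·C₂·V·μ_X(D_E)⁻¹·𝔉ψ(0)` [(b): the `Φ^M(γ,f)`-slope, `ψ̂(0) = Φ^M(γ, f)`] and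
`B = C₁·μ_X(D_E)·C₂·(B_Tate(ψ) − V μ_X(D_E)⁻¹ 𝔉ψ(0) log H(1))` [(b)+(e)] spelled out; hence (★ GLUE
`classPolynomial_eq_and_eval_zero_eq_of_exists_linear`) the class polynomial and THE UNIPOTENT TERM
`p_𝔬(0) = μ(X)·f(z₁) + c_μ·(Cc + B)`.

## References

* J. D. Rogawski, *Automorphic Representations of Unitary Groups in Three Variables*, Annals of Mathematics Studies 123 (1990),
  Prop. 7.3.2 (pp. 96–97), Lemma 7.1.1 (pp. 89–90) [Rogawski1990].
* J. Arthur, *The trace formula in invariant form*, Ann. of Math. 114 (1981), Prop. 2.3 [Arthur1981TraceFormulaInvariantForm].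
-/

set_option autoImplicit false

noncomputable section

open MeasureTheory MeasureTheory.Measure NumberField IsDedekindDomain Set Filter Polynomial Function Literature.MeasureTheory.Group
open scoped ENNReal NNReal MatrixGroups
open Literature.NumberTheory.Automorphic.Meyer

namespace Literature.NumberTheory.Automorphic

namespace UnitaryGroup

variable {F E : Type} [Field F] [NumberField F] [Field E] [NumberField E] [Algebra F E]
  {c : E ≃ₐ[F] E} {ι : Type*}

variable (ζ : ratOne F E c) {z₁ : (quasiSplit F E c 3).arithmeticSubgroup}
  [MeasurableSpace (adelicUnipotent F E c 3)] [BorelSpace (adelicUnipotent F E c 3)]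
  [MeasurableSpace (quasiSplit F E c 3).Adelic] [BorelSpace (quasiSplit F E c 3).Adelic]
  [MeasurableSpace (AdeleRing (𝓞 E) E)] [BorelSpace (AdeleRing (𝓞 E) E)] [LocallyCompactSpace (AdeleRing (𝓞 E) E)]
  [MeasurableSpace (GaloisRepresentations.ideleGroup E)] [BorelSpace (GaloisRepresentations.ideleGroup E)]

/-- **THE UNIPOTENT TERM, (E) ROAD DISCHARGED** [Rogawski1990, Prop. 7.3.2 (pp. 96–97)]. For a quadratic `E∕F` (`[E:F] = 2`,
`c² = 1`, `c ≠ 1`), the central class `𝔬 = cl⁻¹{i} = {charpoly = (X − z)³}`, `f ∈ C_c(G(𝔸_F))`, an automorphic measure `μ`, an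
inversion-invariant Haar measure `ν_G`, a covering weight `β` of `B(F)♯`, the LAW-3 integrability `hkint`, the Haar data
`μ_B, μ_K, μ_T, μ_X, μ_Y, ν_I`, the Iwasawa decomposition `hBK`, a covering weight `w_T` of `T(F)`, an idele class domain `𝓕_E`, and
GIVEN the centre-lattice letters `hCinv hCfin hCi hCv` ((C) road), the `K_U`-average `hκ hκi` ((ET-κ)) and `hψ : ψ ∈ 𝒮(𝔸_E)`:
there are `C₁ > 0`, `C₂ ∈ (0,∞)`, `T₂` with `J^T_𝔬(f) = (c_μ A)·log T + (μ(X)·f(z₁) + c_μ (Cc + B))` for all `T > T₂`, `A`, `B`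
the explicit (E) constants. ★ (F) `_of_parts` ∘ ★ `bracket_eq_centrePart_add_heisPart` ∘ ★ `heisPart_integral_eq_linear` ∘ ★ (HINT).
[cite: Rogawski1990, Prop. 7.3.2 (pp. 96–97)] [cite: Arthur1981TraceFormulaInvariantForm, Prop. 2.3] -/
theorem truncatedTraceClass_central_eq_linear {cl : (quasiSplit F E c 3).arithmeticSubgroup → ι}
    (h2 : Module.finrank F E = 2) (hc : c * c = 1) (hc1 : c ≠ 1)
    (hz₁ : (z₁ : (quasiSplit F E c 3).Adelic) =
      (quasiSplit F E c 3).toAdelic (ratCenter F E c 3 ((StdForm.antidiagonal 3).over E) ζ))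
    {i : ι} (hcl : ∀ γ : (quasiSplit F E c 3).arithmeticSubgroup, cl γ = i ↔
      ((adelicVal F E c 3 _ (γ : (quasiSplit F E c 3).Adelic) : GL (Fin 3) (AdeleRing (𝓞 E) E)) :
          Matrix (Fin 3) (Fin 3) (AdeleRing (𝓞 E) E)).charpoly =
        ((X - C ((ζ : Eˣ) : E)) ^ 3).map (algebraMap E (AdeleRing (𝓞 E) E)))
    (hclN : IsUnipotentInvariantOnBorel F E c 3 cl)
    (ν : Measure (adelicUnipotent F E c 3)) [ν.IsHaarMeasure]
    {𝓕 : Set (adelicUnipotent F E c 3)} (h𝓕 : IsFundamentalDomain (rationalUnipotent F E c 3) 𝓕 ν)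
    {f : (quasiSplit F E c 3).Adelic → ℂ} (hfc : Continuous f) (hf : HasCompactSupport f)
    (μ : Measure (quasiSplit F E c 3).automorphicQuotient) [(quasiSplit F E c 3).IsAutomorphicMeasure μ]
    (νG : Measure (quasiSplit F E c 3).Adelic) [νG.IsHaarMeasure] [νG.IsInvInvariant]
    {β : (quasiSplit F E c 3).Adelic → ℝ≥0∞}
    (hβ : IsCoveringWeight ((arithmeticBorel F E c 3).map (quasiSplit F E c 3).arithmeticSubgroup.subtype) β)
    (hkint : ∃ T₀ : ℝ≥0, ∀ T : ℝ≥0, T₀ < T →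
      Integrable ((quasiSplit F E c 3).quotFun (truncatedKernelClass ν 𝓕 T cl i f)) μ)
    (μB : Measure (borelAdelic F E c 3)) [μB.IsHaarMeasure]
    (μK : Measure ((standardMaximalCompactGL 3 E).comap
      (adelicVal F E c 3 ((StdForm.antidiagonal 3).over E)) : Subgroup (quasiSplit F E c 3).Adelic))
    [μK.IsHaarMeasure]
    (hBK : ∀ g : (quasiSplit F E c 3).Adelic, ∃ b ∈ borelAdelic F E c 3, ∃ k : (quasiSplit F E c 3).Adelic,
      adelicVal F E c 3 ((StdForm.antidiagonal 3).over E) k ∈ standardMaximalCompactGL 3 E ∧ g = b * k)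
    (μT : Measure (torusInBorel F E c 3)) [μT.IsHaarMeasure]
    (μX : Measure (AdeleRing (𝓞 E) E)) [μX.IsAddHaarMeasure]
    (μY : Measure (traceZeroAdele F E c)) [μY.IsAddHaarMeasure]
    {wT : torusInBorel F E c 3 → ℝ≥0∞}
    (hwT : IsCoveringWeight ((((quasiSplit F E c 3).arithmeticSubgroup).subgroupOf (borelAdelic F E c 3)).subgroupOf
      (torusInBorel F E c 3)) wT)
    -- the centre-lattice letters ((C) road, Prop. 7.3.2 (c)+(d))
    (hCinv : ∀ b ∈ arithmeticBorel F E c 3, ∀ y : (quasiSplit F E c 3).Adelic,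
      (∑' w : {w : rationalTraceZero F E c // w ≠ 0},
        f (((b : (quasiSplit F E c 3).Adelic) * y)⁻¹ * ((z₁ : (quasiSplit F E c 3).Adelic) *
          (((heisChart hc ((0 : AdeleRing (𝓞 E) E), ((w.1 : rationalTraceZero F E c) : traceZeroAdele F E c))) :
            adelicUnipotent F E c 3) : (quasiSplit F E c 3).Adelic)) * ((b : (quasiSplit F E c 3).Adelic) * y))) =
      ∑' w : {w : rationalTraceZero F E c // w ≠ 0},
        f (y⁻¹ * ((z₁ : (quasiSplit F E c 3).Adelic) *
          (((heisChart hc ((0 : AdeleRing (𝓞 E) E), ((w.1 : rationalTraceZero F E c) : traceZeroAdele F E c))) :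
            adelicUnipotent F E c 3) : (quasiSplit F E c 3).Adelic)) * y))
    (hCfin : ∫⁻ g, β g * ‖∑' w : {w : rationalTraceZero F E c // w ≠ 0},
        f (g⁻¹ * ((z₁ : (quasiSplit F E c 3).Adelic) *
          (((heisChart hc ((0 : AdeleRing (𝓞 E) E), ((w.1 : rationalTraceZero F E c) : traceZeroAdele F E c))) :
            adelicUnipotent F E c 3) : (quasiSplit F E c 3).Adelic)) * g)‖ₑ ∂νG < ∞)
    {Cc : ℂ}
    (hCi : Integrable (fun g : (quasiSplit F E c 3).Adelic => (β g).toReal •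
      (∑' w : {w : rationalTraceZero F E c // w ≠ 0},
        f (g⁻¹ * ((z₁ : (quasiSplit F E c 3).Adelic) *
          (((heisChart hc ((0 : AdeleRing (𝓞 E) E), ((w.1 : rationalTraceZero F E c) : traceZeroAdele F E c))) :
            adelicUnipotent F E c 3) : (quasiSplit F E c 3).Adelic)) * g))) νG)
    (hCv : ∫ g, (β g).toReal •
      (∑' w : {w : rationalTraceZero F E c // w ≠ 0},
        f (g⁻¹ * ((z₁ : (quasiSplit F E c 3).Adelic) *
          (((heisChart hc ((0 : AdeleRing (𝓞 E) E), ((w.1 : rationalTraceZero F E c) : traceZeroAdele F E c))) :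
            adelicUnipotent F E c 3) : (quasiSplit F E c 3).Adelic)) * g)) ∂νG = Cc)
    -- the (E) road letters
    (νI : Measure (GaloisRepresentations.ideleGroup E)) [νI.IsHaarMeasure]
    {𝓕E : Set (GaloisRepresentations.ideleGroup E)} (h𝓕E : IsIdeleClassDomain E 𝓕E)
    -- (ET-κ) the `K_U`-average of the `ξ`-sum, fibre by fibre (leaf; `T`-free)
    (hκ : ∀ t : torusInBorel F E c 3,
      ∫ k, (∑' ξ : {ξ : E // ξ ≠ 0}, ∫ y' : traceZeroAdele F E c,
        f ((((t : borelAdelic F E c 3) : (quasiSplit F E c 3).Adelic) * (k : (quasiSplit F E c 3).Adelic))⁻¹ *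
          ((z₁ : (quasiSplit F E c 3).Adelic) *
            (((heisChart hc (algebraMap E (AdeleRing (𝓞 E) E) (ξ : E), y')) : adelicUnipotent F E c 3) :
              (quasiSplit F E c 3).Adelic)) *
          (((t : borelAdelic F E c 3) : (quasiSplit F E c 3).Adelic) * (k : (quasiSplit F E c 3).Adelic))) ∂μY) ∂μK =
      ∑' ξ : {ξ : E // ξ ≠ 0}, ∫ y' : traceZeroAdele F E c,
        (∫ k, f ((k : (quasiSplit F E c 3).Adelic)⁻¹ * ((z₁ : (quasiSplit F E c 3).Adelic) *
          ((((t : borelAdelic F E c 3) : (quasiSplit F E c 3).Adelic))⁻¹ *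
            (((heisChart hc (algebraMap E (AdeleRing (𝓞 E) E) (ξ : E), y')) : adelicUnipotent F E c 3) :
              (quasiSplit F E c 3).Adelic) *
            ((t : borelAdelic F E c 3) : (quasiSplit F E c 3).Adelic))) * (k : (quasiSplit F E c 3).Adelic)) ∂μK) ∂μY)
    (hκi : ∀ t : torusInBorel F E c 3, Integrable (fun k : ((standardMaximalCompactGL 3 E).comap
        (adelicVal F E c 3 ((StdForm.antidiagonal 3).over E)) : Subgroup (quasiSplit F E c 3).Adelic) =>
      ∑' ξ : {ξ : E // ξ ≠ 0}, ∫ y' : traceZeroAdele F E c,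
        f ((((t : borelAdelic F E c 3) : (quasiSplit F E c 3).Adelic) * (k : (quasiSplit F E c 3).Adelic))⁻¹ *
          ((z₁ : (quasiSplit F E c 3).Adelic) *
            (((heisChart hc (algebraMap E (AdeleRing (𝓞 E) E) (ξ : E), y')) : adelicUnipotent F E c 3) :
              (quasiSplit F E c 3).Adelic)) *
          (((t : borelAdelic F E c 3) : (quasiSplit F E c 3).Adelic) * (k : (quasiSplit F E c 3).Adelic))) ∂μY) μK)
    -- Rogawski's `ψ` is Schwartz–Bruhat
    (hψ : (fun x => ∫ y' : traceZeroAdele F E c,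
        (∫ k, f ((k : (quasiSplit F E c 3).Adelic)⁻¹ * ((z₁ : (quasiSplit F E c 3).Adelic) *
          (((heisChart hc (x, y')) : adelicUnipotent F E c 3) :
              (quasiSplit F E c 3).Adelic)) * (k : (quasiSplit F E c 3).Adelic)) ∂μK) ∂μY) ∈ schwartzBruhatAdele E)
    :
    haveI := t2Space_adeleRing_of_numberField E
    haveI := locallyCompactSpace_adeleRing' E
    haveI := secondCountableTopology_adeleRing E
    haveI : T2Space (quasiSplit F E c 3).Adelic :=
      inferInstanceAs (T2Space (adelic F E c 3 ((StdForm.antidiagonal 3).over E)))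
    haveI : LocallyCompactSpace (quasiSplit F E c 3).Adelic :=
      inferInstanceAs (LocallyCompactSpace (adelic F E c 3 ((StdForm.antidiagonal 3).over E)))
    haveI : SecondCountableTopology (quasiSplit F E c 3).Adelic :=
      inferInstanceAs (SecondCountableTopology (adelic F E c 3 ((StdForm.antidiagonal 3).over E)))
    haveI : DiscreteTopology (quasiSplit F E c 3).quotientSubgroup := by
      rw [quotientSubgroup_quasiSplit]; exact isDiscreteRational_quasiSplit
    letI := AdelicGroupData.measurableSpaceQuotientForm (quasiSplit F E c 3)
    haveI := AdelicGroupData.borelSpaceQuotientForm (quasiSplit F E c 3)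
    haveI := AdelicGroupData.smulInvariantMeasureQuotientForm (quasiSplit F E c 3) μ
    haveI := AdelicGroupData.isFiniteMeasureOnCompactsQuotientForm (quasiSplit F E c 3) μ
    ∃ C₁ : ℝ, 0 < C₁ ∧ ∃ C₂ : ℝ≥0∞, C₂ ≠ 0 ∧ C₂ ≠ ∞ ∧ ∃ T₂ : ℝ≥0, ∀ T : ℝ≥0, T₂ < T →
      truncatedTraceClass μ ν 𝓕 T cl i f =
        ((unfoldingConstant (quasiSplit F E c 3).quotientSubgroup
            (count : Measure (quasiSplit F E c 3).quotientSubgroup) μ νG : ℝ) : ℂ) *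
          ((C₁ : ℂ) * ((μX.real (adeleFundamentalDomain E) : ℂ) * (C₂.toReal : ℂ)) *
            (((idelicCovolume E νI).toReal : ℂ) * (((μX (adeleFundamentalDomain E)).toReal⁻¹ : ℂ) *
              adeleFourier E μX (fun x => ∫ y' : traceZeroAdele F E c,
        (∫ k, f ((k : (quasiSplit F E c 3).Adelic)⁻¹ * ((z₁ : (quasiSplit F E c 3).Adelic) *
          (((heisChart hc (x, y')) : adelicUnipotent F E c 3) :
              (quasiSplit F E c 3).Adelic)) * (k : (quasiSplit F E c 3).Adelic)) ∂μK) ∂μY) 0))) *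
            ((Real.log (T : ℝ) : ℝ) : ℂ) +
          ((μ.real Set.univ : ℝ) • f (z₁ : (quasiSplit F E c 3).Adelic) +
            ((unfoldingConstant (quasiSplit F E c 3).quotientSubgroup
            (count : Measure (quasiSplit F E c 3).quotientSubgroup) μ νG : ℝ) : ℂ) * (Cc +
          ((C₁ : ℂ) * ((μX.real (adeleFundamentalDomain E) : ℂ) * (C₂.toReal : ℂ)) *
            (((∫ x in {x | 1 ≤ (IdeleClassGroup.ideleNorm E x : ℝ)} ∩ 𝓕E,
                  ideleSum E (fun x => ∫ y' : traceZeroAdele F E c,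
        (∫ k, f ((k : (quasiSplit F E c 3).Adelic)⁻¹ * ((z₁ : (quasiSplit F E c 3).Adelic) *
          (((heisChart hc (x, y')) : adelicUnipotent F E c 3) :
              (quasiSplit F E c 3).Adelic)) * (k : (quasiSplit F E c 3).Adelic)) ∂μK) ∂μY) x * ((IdeleClassGroup.ideleNorm E x : ℝ) : ℂ) ∂νI) +
                ((μX (adeleFundamentalDomain E)).toReal⁻¹ : ℂ) *
                  (∫ x in {x | 1 ≤ (IdeleClassGroup.ideleNorm E x : ℝ)} ∩ 𝓕E,
                    ideleSum E (adeleFourier E μX (fun x => ∫ y' : traceZeroAdele F E c,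
        (∫ k, f ((k : (quasiSplit F E c 3).Adelic)⁻¹ * ((z₁ : (quasiSplit F E c 3).Adelic) *
          (((heisChart hc (x, y')) : adelicUnipotent F E c 3) :
              (quasiSplit F E c 3).Adelic)) * (k : (quasiSplit F E c 3).Adelic)) ∂μK) ∂μY)) x ∂νI) -
                ((idelicCovolume E νI).toReal : ℂ) * (fun x => ∫ y' : traceZeroAdele F E c,
        (∫ k, f ((k : (quasiSplit F E c 3).Adelic)⁻¹ * ((z₁ : (quasiSplit F E c 3).Adelic) *
          (((heisChart hc (x, y')) : adelicUnipotent F E c 3) :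
              (quasiSplit F E c 3).Adelic)) * (k : (quasiSplit F E c 3).Adelic)) ∂μK) ∂μY) 0) -
              (((idelicCovolume E νI).toReal : ℂ) * (((μX (adeleFundamentalDomain E)).toReal⁻¹ : ℂ) *
                  adeleFourier E μX (fun x => ∫ y' : traceZeroAdele F E c,
        (∫ k, f ((k : (quasiSplit F E c 3).Adelic)⁻¹ * ((z₁ : (quasiSplit F E c 3).Adelic) *
          (((heisChart hc (x, y')) : adelicUnipotent F E c 3) :
              (quasiSplit F E c 3).Adelic)) * (k : (quasiSplit F E c 3).Adelic)) ∂μK) ∂μY) 0)) *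
                ((Real.log (borelHeight (1 : (quasiSplit F E c 3).Adelic) : ℝ) : ℝ) : ℂ))))) := by
  -- the (HINT) letter from LAW 3
  obtain ⟨T₀, hT₀⟩ := id hkint
  obtain ⟨Th, hTh⟩ := exists_forall_lintegral_weight_mul_enorm_bracket_lt_top ζ hc hc1 hz₁ hcl hclN ν h𝓕 hfc hf μ νG hβ
  have hHint : ∃ T₀' : ℝ≥0, ∀ T : ℝ≥0, T₀' < T →
      ∫⁻ g, β g * ‖(∑' u : {u : rationalUnipotent F E c 3 // u ≠ 1},
        f (g⁻¹ * ((z₁ * ⟨(((u.1 : rationalUnipotent F E c 3) : adelicUnipotent F E c 3) :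
          (quasiSplit F E c 3).Adelic), (u.1 : rationalUnipotent F E c 3).2⟩ :
            (quasiSplit F E c 3).arithmeticSubgroup) : (quasiSplit F E c 3).Adelic) * g)) -
      kernelBorelTailClass ν 𝓕 T cl i f g‖ₑ ∂νG < ∞ :=
    ⟨max T₀ Th, fun T hT => hTh T (lt_of_le_of_lt (le_max_right _ _) hT) (hT₀ T (lt_of_le_of_lt (le_max_left _ _) hT))⟩
  -- the (E) road
  obtain ⟨C₁, hC₁, C₂, hC₂0, hC₂t, hE⟩ := heisPart_integral_eq_linear ζ h2 hc hc1 hz₁ hclN ν h𝓕 hcl hfc hf νG μB μK hBK μT μX μY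
    hwT hβ hCinv hCfin hHint νI h𝓕E hκ hκi hψ
  refine ⟨C₁, hC₁, C₂, hC₂0, hC₂t, ?_⟩
  exact truncatedTraceClass_central_eq_linear_of_parts ζ hc hc1 hz₁ hcl hclN ν h𝓕 hfc hf μ νG hβ hkint
    (fun T g => bracket_eq_centrePart_add_heisPart hc ν 𝓕 T i hf g) hCi hCv hE

end UnitaryGroup

end Literature.NumberTheory.Automorphic
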